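import Summits.ResolutionOfSingularities.ResolutionOfSingularities.Theorems.FloorDescent5
import Summits.ResolutionOfSingularities.ResolutionOfSingularities.Theorems.FloorCutClasses
import Summits.ResolutionOfSingularities.ResolutionOfSingularities.Theorems.MaxContactCutFloorCut
import Literature.AlgebraicGeometry.Resolution.PointBlowupFlagTranslatedStep
import HarnessLib

/-!
# FloorDescent — the ORDER FLOOR of the deep tight-defect column, DECIDED IN KERNEL (decomp-res · lens-5 g34)

**Target (tree item stmt-ResolutionOfSingularities-27646 `MaxContactCut.FLNoFloorTailsDeep` := `FloorCut.NoFloorTailsDeep`,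
`Theorems/FloorCutClasses.lean`).**  A forced walk of the E-model `x^{pᵉ} + F(y₀,y₁,y₂)` (tree `ForcedWalk`: point
blow-ups at equimultiple points on the new exceptional component, origin an isolated top point at every stage) from a
ROOT state cannot sit on the ORDER FLOOR `ord F_t = pᵉ` from some stage on.  PROVED here for EVERY prime `p` and
EVERY exponent `e` (`noFloorTails`; the class's `2 ≤ e`, `PerfectField` and shade hypotheses are not used), hence
`noFloorTailsDeep_holds : FloorCut.NoFloorTailsDeep` and `flNoFloorTailsDeep_holds : MaxContactCut.FLNoFloorTailsDeep`
(§10 also discharges `hT` in the landed wiring `FloorCut.defectDeep_iff_pieces'` etc.).  Sorry-free; axioms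
`propext, Classical.choice, Quot.sound`; imports landed modules only; no Literature fact, no port, no kit.

**Mechanism (honest placement).**  This is the E-model transplant of the classical δ-DESCENT of Hironaka /
Cossart–Jannsen–Saito for point blow-ups at near points (CossartJannsenSaito2020 Thm 5.35 / Cor 5.37 / Thm 9.2;
Hauser2010 §§F–G): along the walk one builds, at every stage `t ≥ N` and for every DEPTH `m`, a polynomial FRAME
`y_i ↦ y_i + r_i(y_j)` (`r_i(0) = 0`, a truncated arc through the future centres) in which `F_t` satisfies the ARC
CONDITION `ArcCond j q m` — every monomial `y^d` of the framed equation is a `q`-th power or has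
`m·(q − |d|_{≠j}) ≤ d_j` (the monomial form of `F ∈ (y_j^m, y_{≠j})^q + K[y^q]`, i.e. Hironaka's vertex condition
`δ ≥ m`).  Four laws, each a separate theorem:
* (L1) `lift_law` — LIFT `m ↦ m+1` through one point blow-up in the same chart (pure exponent arithmetic on the cone
  map `y_i ↦ y_i y_j`; consumes `ord F_t ≥ q`, `b_t(j_t) = 0`, and that cleaning only removes `K[y^q]`);
* (L2) `conversion_law` — CONVERSION of a `j'`-based frame into a `j`-based frame of the same depth across a change
  of chart index, under TRANSVERSALITY `r_j'(0) ≠ 0` (truncated compositional inverse, Newton; ideal inclusion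
  `T S'⁻¹(y_{j'}^m, y_{≠j'}) ⊆ (y_j^m, y_{≠j})`);
* (L3) `transversality_law` — on the FLOOR (`F_t` cleaned with a monomial of degree exactly `q`) a change of chart
  index `j_{t+1} ≠ j_t` forces `b_{t+1}(j_t) ≠ 0` (three variables; a `q`-power bookkeeping of the degree-`q` part
  read at stages `t` and `t+1`; THE ONLY USE OF THE FLOOR);
* (L4) `isolation_law` — frames of every depth at a FIXED stage contradict `IsolatedTop`: `topIdeal q (S F) ≤
  (y_j^m, y_{≠j})` (`topIdeal_le_arcIdeal`, Hasse derivatives of `q`-th powers vanish below degree `q`) and the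
  TRANSPORT `topIdeal q (θ G) ≤ (topIdeal q G).map θ` (`topIdeal_map_le`, Taylor formula in the polynomial ring).
The descent `floor_descent` is the induction on the depth, descending in `t`; `noFloorTails` applies (L4) at `t = N`.
What is new is not the idea but the CURRENCY: a hypothesis-free kernel proof in the tree's E-model for all `p, e`
(the previous record, lens-3 g14, was DECIDED-MOD-PORT for `p ≥ 3` via the CJS `e = 1` port with a `p = 2` rider;
here `p = 2` needs nothing special), with (L3) proved by elementary `q`-power bookkeeping instead of directrix theory
(CJS Thm 2.14) and (L4) by Hasse–Schmidt transport instead of the Hilbert–Samuel stratum.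

Sections: §1 exponents · §2 `IsQPow`/`ArcCond` · §3 `OrdGE` · §4 cone map, frames, shears · §5 (L1) · §6 (L4) ·
§7 (L3) · §8 (L2) · §9 descent + `noFloorTailsDeep_holds` · §10 wiring corollaries by name.
(Sources: CossartJannsenSaito2020 Def. 5.34, Thm 5.35, Cor 5.37, Thm 9.2; Hauser2010 §§C, F, G; Hironaka 1967
(characteristic polyhedra); CossartPiltant2019.)
-/

open MvPolynomial Finset
open scoped BigOperators Polynomial
open Literature.AlgebraicGeometry.Resolution
open Literature.AlgebraicGeometry.Resolution.Hauser2010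
open Literature.AlgebraicGeometry.Resolution.PointBlowup
open Literature.AlgebraicGeometry.Resolution.HauserPerlega2024
open Summit.ResolutionOfSingularities.ResolutionOfSingularities.Theorems.TightDefectClasses

namespace Summit.ResolutionOfSingularities.ResolutionOfSingularities.Theorems.FloorDescent


noncomputable section


/-! ## §9 THE FLOOR DESCENT — `NoFloorTailsDeep` DECIDED (all `p`, all `e`) -/

section Main

variable {K : Type} [Field K]

/-- Order `≥ q` is the arc condition of depth one. [folklore] -/
theorem arcCond_one_of_ordGE {σ : Type} [DecidableEq σ] [Fintype σ] {q : ℕ} {j : σ} {G : MvPolynomial σ K}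
    (hG : OrdGE q G) : ArcCond j q 1 G := by
  intro d hd
  right
  have h1 := hG d hd
  have h2 := degree_eq_offDeg_add j d
  rw [one_mul]; omega

/-- On an exact order floor the equation has a monomial of degree `q`. [folklore] -/
theorem exists_degree_eq_of_ordZero_eq {σ : Type} {q : ℕ} {F : MvPolynomial σ K}
    (h : ordZero F = (q : ℕ∞)) : ∃ d ∈ F.support, d.degree = q := by
  obtain ⟨⟨d, hd, hdeg⟩, -⟩ := (ordZero_eq_nat_iff F q).mp h
  exact ⟨d, MvPolynomial.mem_support_iff.mpr hd, hdeg⟩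

/-- Every state of a forced walk from a root is CLEANED. [folklore] -/
theorem walk_clean [DecidableEq K] {q : ℕ} {s₀ : State (Fin 3) K} (hs : IsRoot q s₀) (W : ForcedWalk q s₀)
    (t : ℕ) : deletePthPowers q (W.st t).F = (W.st t).F := by
  cases t with
  | zero => rw [W.st_zero]; exact hs.2.1
  | succ t =>
    rw [W.st_succ t]
    exact deletePthPowers_deletePthPowers q (pointTransform q (W.j t) (W.b t) (W.st t))

/-- Every state of a forced walk from a root has ORDER `≥ q` (root condition / equimultiplicity). [folklore] -/
theorem walk_ordGE [DecidableEq K] {q : ℕ} {s₀ : State (Fin 3) K} (hs : IsRoot q s₀) (W : ForcedWalk q s₀)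
    (t : ℕ) : OrdGE q (W.st t).F := by
  rw [ordGE_iff_ordZero]
  cases t with
  | zero => rw [W.st_zero]; exact hs.2.2
  | succ t =>
    rw [W.st_succ t]
    exact le_ordZero_step_of_isEquimultiplePoint q _ _ _ (W.equimult t)

/-- **THE FLOOR DESCENT** (`q = p^e`, three variables).  Along a forced walk sitting on the order floor
`ord F_t = q` for `t ≥ N`, every stage `t ≥ N` carries, for EVERY depth `n + 1`, a `j_t`-based polynomial frame
(arc `y_i = r_i(y_{j_t})`, `r_i(0) = 0`, linear part the next centre `b_t`) putting `F_t` in the arc condition of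
that depth.  Induction on `n`, DESCENDING in `t`: (L3) transversality + (L2) conversion across a change of chart
index, then (L1) the lift. [new · the E-model form of the Hironaka/CJS `e = 1` δ-descent (CJS2020 Thm 9.2 /
Cor 5.37), char-free and for all `e`] [folklore] -/
theorem floor_descent {p : ℕ} [Fact p.Prime] [CharP K p] [DecidableEq K] (e : ℕ) {s₀ : State (Fin 3) K}
    (hs : IsRoot (p ^ e) s₀) (W : ForcedWalk (p ^ e) s₀) (N : ℕ)
    (hfloor : ∀ t, N ≤ t → ordZero (W.st t).F = ((p ^ e : ℕ) : ℕ∞)) :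
    ∀ n t, N ≤ t → ∃ r : Fin 3 → K[X], (∀ i, (r i).coeff 0 = 0) ∧ (∀ i, i ≠ W.j t → (r i).coeff 1 = W.b t i) ∧
      ArcCond (W.j t) (p ^ e) (n + 1) (frame (W.j t) r (W.st t).F) := by
  intro n
  induction n with
  | zero =>
    intro t _
    refine ⟨shearArc (W.b t), shearArc_coeff_zero _, fun i _ => ?_, ?_⟩
    · show (Polynomial.C (W.b t i) * Polynomial.X).coeff 1 = _
      rw [Polynomial.coeff_C_mul_X, if_pos rfl]
    · exact arcCond_one_of_ordGE ((walk_ordGE hs W t).frame _ _ (shearArc_coeff_zero _))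
  | succ n ih =>
    intro t ht
    obtain ⟨r', hr'0, hr'1, harc'⟩ := ih (t + 1) (by omega)
    have hclean := walk_clean hs W t
    have hord := walk_ordGE hs W t
    have hst : (W.st (t + 1)).F
        = deletePthPowers (p ^ e) (PointBlowup.translate (W.b t) (chartTransform (p ^ e) (W.j t) (W.st t).F)) := by
      rw [W.st_succ t]; rfl
    -- a `j_t`-based frame of depth `n + 1` for `F_{t+1}`
    obtain ⟨r'', hr''0, harc''⟩ : ∃ r'' : Fin 3 → K[X], (∀ i, (r'' i).coeff 0 = 0) ∧
        ArcCond (W.j t) (p ^ e) (n + 1) (frame (W.j t) r'' (W.st (t + 1)).F) := by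
      by_cases hjj : W.j (t + 1) = W.j t
      · refine ⟨r', hr'0, ?_⟩
        rw [← hjj]
        exact harc'
      · -- change of chart index: (L3) transversality gives `b_{t+1}(j_t) ≠ 0`, then (L2) conversion
        have htr : W.b (t + 1) (W.j t) ≠ 0 := by
          intro h0
          have heq' := W.equimult (t + 1)
          rw [W.st_succ t] at heq'
          exact transversality_law e hclean hord (exists_degree_eq_of_ordZero_eq (hfloor t ht)) (W.onExc t)
            (W.equimult t) (W.onExc (t + 1)) hjj h0 heq'
        have h1 : (r' (W.j t)).coeff 1 ≠ 0 := by rw [hr'1 (W.j t) (Ne.symm hjj)]; exact htr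
        exact conversion_law e hjj (n + 1) r' hr'0 h1 harc'
    rw [hst] at harc''
    refine ⟨fun i => shearArc (W.b t) i + Polynomial.X * r'' i, fun i => ?_, fun i _ => ?_,
      lift_law e (W.j t) (W.b t) (W.onExc t) hord r'' harc''⟩
    · rw [Polynomial.coeff_add, shearArc_coeff_zero, Polynomial.mul_coeff_zero, Polynomial.coeff_X_zero,
        zero_mul, add_zero]
    · have hX1 : (Polynomial.X * r'' i).coeff 1 = (r'' i).coeff 0 := Polynomial.coeff_X_mul _ 0
      rw [Polynomial.coeff_add, hX1, hr''0 i, add_zero]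
      show (Polynomial.C (W.b t i) * Polynomial.X).coeff 1 = _
      rw [Polynomial.coeff_C_mul_X, if_pos rfl]

/-- **NO FLOOR TAILS** — for every prime `p`, EVERY exponent `e` (not only `e ≥ 2`), every field of
characteristic `p` (perfectness not used) and every forced walk from a root state (the shade hypothesis of the
tree's class is NOT used): the walk cannot sit on the order floor `ord F_t = p^e` from some stage on.
Proof: the floor descent gives frames of every depth at the fixed stage `N`; (L4) isolation refutes them. [new] [folklore] -/
theorem noFloorTails (p : ℕ) (hp : p.Prime) (e : ℕ) (K : Type) [Field K] [CharP K p] [DecidableEq K]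
    (s₀ : State (Fin 3) K) (hs : IsRoot (p ^ e) s₀) (W : ForcedWalk (p ^ e) s₀) (N : ℕ)
    (hfloor : ∀ t, N ≤ t → ordZero (W.st t).F = ((p ^ e : ℕ) : ℕ∞)) : False := by
  haveI := Fact.mk hp
  refine isolation_law (K := K) e (W.j N) (W.isolated N) fun m => ?_
  obtain ⟨r, hr0, -, harc⟩ := floor_descent e hs W N hfloor m N le_rfl
  exact ⟨r, hr0, harc.mono (Nat.le_succ m)⟩

/-- **`FloorCut.NoFloorTailsDeep` HOLDS** (tree item stmt-ResolutionOfSingularities-27646 =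
`MaxContactCut.FLNoFloorTailsDeep`, by letter `FloorCut.NoFloorTailsDeep`): the ORDER-FLOOR CELL of the deep
tight-defect column is EMPTY — decided in kernel for all `p` (the `2 ≤ e`, `PerfectField` and shade hypotheses
are not used). [new] [folklore] -/
theorem noFloorTailsDeep_holds : FloorCut.NoFloorTailsDeep :=
  fun p hp e _ K _ _ _ _ s₀ hs W _ N hN => noFloorTails p hp e K s₀ hs W N hN

end Main


/-! ## §10 WIRING — the tree item `MaxContactCut.FLNoFloorTailsDeep` and the consumer corollaries BY NAME
(landed wiring `Theorems/MaxContactCutFloorCut.lean`; `hO` discharged by the landed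
`ProximityCut.noOriginTails_holds`). -/

section Wiring

open Summit.ResolutionOfSingularities.ResolutionOfSingularities.Theses
open Summit.ResolutionOfSingularities.ResolutionOfSingularities.Theorems.FloorCut
open Summit.ResolutionOfSingularities.ResolutionOfSingularities.Theorems.BoundaryLedger
open Summit.ResolutionOfSingularities.ResolutionOfSingularities.Theorems.ProximityCut (NoOriginTails noOriginTails_holds)

/-- **Tree item stmt-ResolutionOfSingularities-27646 `MaxContactCut.FLNoFloorTailsDeep` HOLDS** (by letter
`FloorCut.NoFloorTailsDeep`). [new] [folklore] -/
theorem flNoFloorTailsDeep_holds : MaxContactCut.FLNoFloorTailsDeep := noFloorTailsDeep_holds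

/-- Consumer: the BARE critical cell of the boundary ledger is empty (`FloorCut.bare_of_floorTails`). [folklore] -/
theorem noBareTailsDeep_holds : NoBareTailsDeep := bare_of_floorTails noFloorTailsDeep_holds

/-- Consumer: no FLOOR-EDGE plateaux (`FloorCut.floorEdge_of_floorTails'`, through the PROVED no-jump law).
[folklore] -/
theorem noFloorEdgePlateauxDeep_holds : NoFloorEdgePlateauxDeep := floorEdge_of_floorTails' noFloorTailsDeep_holds

/-- **Consumer: the EXACT CUT of the blocker 31770 loses its floor conjunct** —
`DefectWalksTerminateDeep ⟺ NoLoadedCriticalPlateauxDeep ∧ NoHighPlateauxDeepTwo`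
(`FloorCut.defectDeep_iff_pieces'` with `hO := ProximityCut.noOriginTails_holds` and `hT` discharged here). [new] [folklore] -/
theorem defectDeep_iff_pieces_floor :
    DefectWalksTerminateDeep ↔ NoLoadedCriticalPlateauxDeep ∧ NoHighPlateauxDeepTwo :=
  (defectDeep_iff_pieces' noOriginTails_holds).trans
    ⟨fun h => ⟨h.1, h.2.2⟩, fun h => ⟨h.1, noFloorTailsDeep_holds, h.2⟩⟩

/-- Consumer: `MaxContactCut.ICNoPlateauDeep` from the two remaining pieces (`FloorCut.icNoPlateauDeep_of_pieces`).
[folklore] -/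
theorem icNoPlateauDeep_of_pieces_floor (hL : NoLoadedCriticalPlateauxDeep) (hH : NoHighPlateauxDeepTwo) :
    MaxContactCut.ICNoPlateauDeep :=
  icNoPlateauDeep_of_pieces noOriginTails_holds hL noFloorTailsDeep_holds hH

/-- Consumer: `MaxContactCut.DefectWalksDeep` (= 31770) from the two remaining pieces
(`FloorCut.defectWalksDeep_of_pieces'`). [folklore] -/
theorem defectWalksDeep_of_pieces_floor (hL : NoLoadedCriticalPlateauxDeep) (hH : NoHighPlateauxDeepTwo) :
    MaxContactCut.DefectWalksDeep :=
  defectWalksDeep_of_pieces' noOriginTails_holds hL noFloorTailsDeep_holds hH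

/-- Consumer: given the loaded-critical cell, 31770 ⟺ the high-plateau cell (`FloorCut.defectWalksDeep_iff_high'`).
[folklore] -/
theorem defectWalksDeep_iff_high_floor (hL : NoLoadedCriticalPlateauxDeep) :
    MaxContactCut.DefectWalksDeep ↔ NoHighPlateauxDeepTwo :=
  defectWalksDeep_iff_high' noOriginTails_holds hL noFloorTailsDeep_holds

end Wiring


end

end Summit.ResolutionOfSingularities.ResolutionOfSingularities.Theorems.FloorDescent
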